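import Summits.QuantumFields.YangMills.Theorems.UnitScaleTiltProp7Lane2CutoffPackage
import HarnessLib

/-!
# Route `UnitScaleTilt`, crux K1 «MinimiserStabilityRegPr» (stmt-QuantumFields-19200) — LANE II «DIVERGENCE RECOVERY AT CURVED `W`» (★★OWNER RULING №23),
# (B7) member knit [I-9] «(Z0-d)»: **OFF THE CENTRE SET THE CUTOFF MAPS ARE ZERO** — so the per-site rows `hloc`∕`hDφ` of the frozen schema `hPatch` hold trivially at
# every index `c ∉ Zc` with the zero patch data (`φ_c = κs_c = 0`, `r_c = 0`)

Cell `ym3-torus` ∕ width seat `ym3-torus-px4` (gen 9, «width 4»; PATCHES2 (Z0)-side hand per ★p1 g19 2026-08-29 12:26Z).  THEOREMS ONLY (0 `def`, 0 `sorry`);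
`--supports stmt-QuantumFields-19200 --as helper`, count-neutral.  YM₃ on T³ is a ladder rung (R3), NOT d = 4, NOT infinite volume, NOT a mass gap, NOT the Clay problem; nothing here
claims (B7), (REC), `hN06`, E′, EX or the gap.

WHY.  `hPatch` (✓`Prop7DivRecoveryPatchesToRows.hRows_of_core_and_patches` :61–:90) indexes the cutoff families by ALL fine sites and asks, for every index `i`,
`Z i (D*_W y) = Z i (Δ_W φ_i) + Z i (κs_i)` and `ZE i (D_W φ_i) = ZE i y − ZE i (r_i)`.  PATCHES1 supplies these on the centre set `Zc` of ✓`exists_cutoffPackage(_grid)`; off `Zc` the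
package's rows `hoff : ζ c = 0` and the (Z2) readings make `Zs c`, `Zb c` the zero maps, so the two equations hold with zero data.  These are the four one-liners the assembler `exact`s.

WHAT IS PROVED (ns `…Theorems.Prop7Lane2CutoffOffCentre`; letters = the package's `ζ Zs Zb` with `hZs hZb hoff` VERBATIM):
* ★ `siteCutoff_apply_eq_zero_of_not_mem` ∕ ★ `bondCutoff_apply_eq_zero_of_not_mem` — `c ∉ Zc → Zs c φ = 0`, `Zb c f = 0`.
* `hloc_of_not_mem` — `c ∉ Zc → Zs c u = Zs c v + Zs c w` for ANY `u v w` (so in particular `hloc` with `φ_c := 0`, `κs_c := 0`).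
* `hDφ_of_not_mem` — `c ∉ Zc → Zb c u = Zb c v − Zb c w` for ANY `u v w` (so `hDφ` with `φ_c := 0`, `r_c := 0`).
HONEST SCOPE.  Four lines of linear algebra over the package's readings; nothing of the lattice gauge theory or of print; rung R3, not Clay; YM gap NOT proved.

References: T. Bałaban, CMP 99 (1985) 389–434 [Balaban1985BackgroundPropagators] ((3.100) pp.413–414: the partition of unity and its localisations); [folklore].
-/

set_option autoImplicit false

noncomputable section

namespace Summit.QuantumFields.YangMills.Theorems.Prop7Lane2CutoffOffCentre

open Literature.MathematicalPhysics.QuantumFieldTheory.Balaban1983to89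
open Literature.MathematicalPhysics.QuantumFieldTheory.Balaban1983to89.T3ContinuumYM3Torus
open B11Eq103H1Complex (SiteL2K BondL2K)
open Summit.QuantumFields.YangMills.Theorems.Prop7SectET3Transport (periodsT3)
open Summit.QuantumFields.YangMills.Theorems.Prop7SectET3HilbertLetters (W₂ toL2 toL2S)

variable (F : T3Family) (K : ℕ) (c₀ : ℝ)

/-- ★ **OFF THE CENTRE SET THE SITE CUTOFF IS THE ZERO MAP**: from the (Z2) reading `toL2S⁻¹(Zs c φ) x = ζ c x • toL2S⁻¹ φ x` and `ζ c = 0` for `c ∉ Zc`.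
[cite: Balaban1985BackgroundPropagators, (3.100) p.413] -/
theorem siteCutoff_apply_eq_zero_of_not_mem {Zc : Finset (Site (F.P K) 0)} {ζ : Site (F.P K) 0 → Site (F.P K) 0 → ℝ}
    {Zs : Site (F.P K) 0 → (SiteL2K ℂ 3 (periodsT3 F K) c₀ W₂ →ₗ[ℂ] SiteL2K ℂ 3 (periodsT3 F K) c₀ W₂)}
    (hoff : ∀ c, c ∉ Zc → ∀ x, ζ c x = 0)
    (hZs : ∀ c φ x, (toL2S F K c₀).symm (Zs c φ) x = ζ c x • (toL2S F K c₀).symm φ x)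
    {c : Site (F.P K) 0} (hc : c ∉ Zc) (φ : SiteL2K ℂ 3 (periodsT3 F K) c₀ W₂) : Zs c φ = 0 := by
  apply (toL2S F K c₀).symm.injective
  rw [map_zero]
  funext x
  rw [hZs, hoff c hc x, zero_smul]
  rfl

/-- ★ **OFF THE CENTRE SET THE BOND CUTOFF IS THE ZERO MAP**: from the (Z2) reading `toL2⁻¹(Zb c f) b = ζ c b.src • toL2⁻¹ f b` and `ζ c = 0` for `c ∉ Zc`.
[cite: Balaban1985BackgroundPropagators, (3.100) p.413] -/
theorem bondCutoff_apply_eq_zero_of_not_mem {Zc : Finset (Site (F.P K) 0)} {ζ : Site (F.P K) 0 → Site (F.P K) 0 → ℝ}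
    {Zb : Site (F.P K) 0 → (BondL2K ℂ 3 (periodsT3 F K) c₀ W₂ →ₗ[ℂ] BondL2K ℂ 3 (periodsT3 F K) c₀ W₂)}
    (hoff : ∀ c, c ∉ Zc → ∀ x, ζ c x = 0)
    (hZb : ∀ c f b, (toL2 F K c₀).symm (Zb c f) b = ζ c b.src • (toL2 F K c₀).symm f b)
    {c : Site (F.P K) 0} (hc : c ∉ Zc) (f : BondL2K ℂ 3 (periodsT3 F K) c₀ W₂) : Zb c f = 0 := by
  apply (toL2 F K c₀).symm.injective
  rw [map_zero]
  funext b
  rw [hZb, hoff c hc b.src, zero_smul]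
  rfl

/-- **`hloc` OFF THE CENTRE SET**: for `c ∉ Zc`, `Zs c u = Zs c v + Zs c w` for any three site vectors (all sides vanish) — `hPatch`'s local equation at such an index with zero patch data.
[cite: Balaban1985BackgroundPropagators, (3.100) p.413] -/
theorem hloc_of_not_mem {Zc : Finset (Site (F.P K) 0)} {ζ : Site (F.P K) 0 → Site (F.P K) 0 → ℝ}
    {Zs : Site (F.P K) 0 → (SiteL2K ℂ 3 (periodsT3 F K) c₀ W₂ →ₗ[ℂ] SiteL2K ℂ 3 (periodsT3 F K) c₀ W₂)}
    (hoff : ∀ c, c ∉ Zc → ∀ x, ζ c x = 0)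
    (hZs : ∀ c φ x, (toL2S F K c₀).symm (Zs c φ) x = ζ c x • (toL2S F K c₀).symm φ x)
    {c : Site (F.P K) 0} (hc : c ∉ Zc) (u v w : SiteL2K ℂ 3 (periodsT3 F K) c₀ W₂) : Zs c u = Zs c v + Zs c w := by
  rw [siteCutoff_apply_eq_zero_of_not_mem F K c₀ hoff hZs hc, siteCutoff_apply_eq_zero_of_not_mem F K c₀ hoff hZs hc,
    siteCutoff_apply_eq_zero_of_not_mem F K c₀ hoff hZs hc, add_zero]

/-- **`hDφ` OFF THE CENTRE SET**: for `c ∉ Zc`, `Zb c u = Zb c v − Zb c w` for any three bond vectors (all sides vanish) — `hPatch`'s gradient equation at such an index with zero patch data.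
[cite: Balaban1985BackgroundPropagators, (3.100) p.413] -/
theorem hDφ_of_not_mem {Zc : Finset (Site (F.P K) 0)} {ζ : Site (F.P K) 0 → Site (F.P K) 0 → ℝ}
    {Zb : Site (F.P K) 0 → (BondL2K ℂ 3 (periodsT3 F K) c₀ W₂ →ₗ[ℂ] BondL2K ℂ 3 (periodsT3 F K) c₀ W₂)}
    (hoff : ∀ c, c ∉ Zc → ∀ x, ζ c x = 0)
    (hZb : ∀ c f b, (toL2 F K c₀).symm (Zb c f) b = ζ c b.src • (toL2 F K c₀).symm f b)
    {c : Site (F.P K) 0} (hc : c ∉ Zc) (u v w : BondL2K ℂ 3 (periodsT3 F K) c₀ W₂) : Zb c u = Zb c v - Zb c w := by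
  rw [bondCutoff_apply_eq_zero_of_not_mem F K c₀ hoff hZb hc, bondCutoff_apply_eq_zero_of_not_mem F K c₀ hoff hZb hc,
    bondCutoff_apply_eq_zero_of_not_mem F K c₀ hoff hZb hc, sub_zero]

end Summit.QuantumFields.YangMills.Theorems.Prop7Lane2CutoffOffCentre

end
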